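import Summits.ABC.StewartYu.GenThreeVanishingOrbit
import Mathlib.Analysis.Complex.Basic
import HarnessLib

/-!
# Gen-3 engines ⇒ the zero estimate, VI: rational generators as points of `𝔾ₐ × 𝔾ₘ^m(ℂ)`

`Summits/ABC/StewartYu/GenThreeVanishingRat.lean` — cell `abc-stewartyu` (route `PadicPrimesKummerThird`,
cruxes `Y07Odd` stmt-ABC-19658 / `Y07Two` stmt-ABC-19659), seat p3 (g4).  Theorems only.

The engine texts (`GenThreeEngineOdd` / `GenThreeEngineTwo`) quantify over nonzero RATIONAL generators
`α : Fin m → ℚ` with the multiplicative independence hypothesis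
`∀ μ : Fin m → ℤ, ∏ j, α j ^ μ j = 1 → μ = 0`; the V package (`GenThreeVanishing*`) wants the torus
coordinates as complex units `ξ : Fin m → ℂˣ` with the same hypothesis (`hind`).  This file is the
one-line transport: `ξⱼ := Units.mk0 (αⱼ : ℂ)` (`unitsOfRat`-shape, written inline),
`hind_units_of_rat`, and the pivot `exists_pivot_of_ne_zero` (`b ≠ 0 ⇒ ∃ j₀, b j₀ ≠ 0`), so that a frame
instantiates `exists_obstruction_of_laurentIdentities` / `ncard_image_mk_zpowSet` directly from the
engine text's data.
-/

noncomputable section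

open Finset
open Literature.NumberTheory.Transcendental
open Literature.NumberTheory.Transcendental.GaGm

namespace Summit.ABC.StewartYu.GenThreeVanishing

variable {m : ℕ}

/-- Casting a rational monomial identity to `ℂ`: `∏ (αⱼ : ℂ)^{μⱼ} = ((∏ αⱼ^{μⱼ} : ℚ) : ℂ)`. [folklore] -/
theorem prod_zpow_ratCast (α : Fin m → ℚ) (μ : Fin m → ℤ) :
    ∏ j, ((α j : ℂ)) ^ μ j = (((∏ j, α j ^ μ j : ℚ)) : ℂ) := by
  push_cast
  rfl

/-- **Multiplicative independence transports from `ℚ` to the complex units** `ξⱼ = (αⱼ : ℂ)`: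
the hypothesis `hind` of `ncard_image_mk_zpowSet` from the engine text's independence hypothesis. [folklore] -/
theorem hind_units_of_rat (α : Fin m → ℚ) (hα : ∀ j, α j ≠ 0)
    (hind : ∀ μ : Fin m → ℤ, ∏ j, α j ^ μ j = 1 → μ = 0) :
    ∀ φ : Fin m → ℤ,
      ∏ j, (Units.mk0 ((α j : ℂ)) (by exact_mod_cast hα j) : ℂˣ) ^ φ j = 1 → φ = 0 := by
  intro φ h
  apply hind φ
  have h1 : ((∏ j, (Units.mk0 ((α j : ℂ)) (by exact_mod_cast hα j) : ℂˣ) ^ φ j : ℂˣ) : ℂ) = 1 := by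
    rw [h]; rfl
  rw [Units.coe_prod] at h1
  simp only [Units.val_zpow_eq_zpow_val, Units.val_mk0] at h1
  rw [prod_zpow_ratCast] at h1
  exact_mod_cast h1

/-- The value of the unit `Units.mk0 (αⱼ : ℂ)` is `(αⱼ : ℂ)`. [folklore] -/
theorem val_units_of_rat (α : Fin m → ℚ) (hα : ∀ j, α j ≠ 0) (j : Fin m) :
    ((Units.mk0 ((α j : ℂ)) (by exact_mod_cast hα j) : ℂˣ) : ℂ) = (α j : ℂ) := rfl

/-- A nonzero integer vector has a pivot coordinate. [folklore] -/
theorem exists_pivot_of_ne_zero (b : Fin m → ℤ) (hb : b ≠ 0) : ∃ j₀, b j₀ ≠ 0 := by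
  by_contra h
  push Not at h
  exact hb (funext h)

end Summit.ABC.StewartYu.GenThreeVanishing

end
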